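import Mathlib
import Summits.CriticalPhenomena.PercolationContinuityZ3.Theorems.PercNearOneGluingNoHeavyLowerTailOrderedDifferencesTwoChain

/-!
# The Marica–Schönheim pencil over every field: reduction to reciprocal certificates

Helper file for crux `stmt-CriticalPhenomena-4575` (`NoHeavyLowerTail`, route `PercNearOneGluingNoHeavy`),
new-inequality factory seat `prim-ineq-gen-3` (gen 22).  Everything here is PROVED; no definitions.

Notation (memo `run/shared/lean/prim/prim-ineq-gen-3/CONJECTURE-P2.md`): for a finite family `ℬ` with difference family
`D = ℬ \\ ℬ`, the containment columns are `Z C E = [E ⊆ C]` and the avoidance columns `Y C E = [E ∩ C = ∅]`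
(`C ∈ ℬ`, `E ∈ D`); the PENCIL rows are `E ↦ Z C E + t • Y C E`.

A RECIPROCAL CERTIFICATE for a member `A ∈ ℬ` is a pair of coefficient vectors `p q : D → K` with
`Z p = δ_A`, `Y q = δ_A` and `Y p = Z q` (as functions of the member `C`), i.e.
`∑_E p_E [E ⊆ C] = [C = A] = ∑_E q_E [E ∩ C = ∅]` and `∑_E p_E [E ∩ C = ∅] = ∑_E q_E [E ⊆ C]`.
Equivalently `(1 - t²) δ_A = ∑_E (p_E - t q_E) (Z E + t Y E)`, a degree-one "swap certificate"; conjecture P2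
(2-chain periodicity) is equivalent to every member of every family having one (CONJECTURE-P2.md §1 (c)/(e)).

* `linearIndependent_pencil_of_certificates` — if every NONEMPTY SUB-FAMILY `ℬ ⊆ 𝒜` has at least ONE member with a
  reciprocal certificate (w.r.t. `ℬ`), then the pencil rows of `𝒜` over `𝒜 \\ 𝒜` are linearly independent for every
  `t` with `t * t ≠ 1`, over any field.  [A dependency `c` restricts to a full-support dependency of the sub-family
  `ℬ = supp c`; pairing it with `p` and with `q` gives `c_A + t X = 0 = X + t c_A`, so `c_A = t² c_A`.]  This is the
  inductive skeleton behind "LEMMA-TARGET" of gen 22: one certified member per family suffices for MS-PENCIL over every field.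
* `certificate_of_powerset_subset_of_subset_iff` / `certificate_of_powerset_subset_of_disjoint_iff` — the two cheapest
  certificates: a column `E` all of whose subsets are columns and whose only container (resp. only avoider) in `ℬ` is `A`
  (Möbius inversion over `E.powerset`).
* `certificate_of_reciprocal_columns` — two columns `E, E'` with `[E ⊆ C] = [E' ∩ C = ∅] = [C = A]` and
  `[E ∩ C = ∅] = [E' ⊆ C]` (e.g. `E = A \ B`, `E' = B \ A` in general position).
(prim-ineq-gen-3 gen 22, 2026-08-24.)
-/

namespace Summit.CriticalPhenomena.PercolationContinuityZ3.Theorems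

namespace OrderedDifferences

open Finset
open scoped FinsetFamily

variable {α : Type*} [DecidableEq α] {K : Type*} [Field K]

/-- Fubini step used twice below: pairing the pointwise dependency with a coefficient vector `r` on the columns. -/
private theorem pair_dependency_aux (ℬ : Finset (Finset α)) (c' r : Finset α → K) (t : K) :
    ∑ E ∈ ℬ \\ ℬ, r E * ∑ C ∈ ℬ, c' C * ((if E ⊆ C then (1 : K) else 0) +
        t * (if Disjoint E C then (1 : K) else 0)) =
      ∑ C ∈ ℬ, c' C * (∑ E ∈ ℬ \\ ℬ, r E * (if E ⊆ C then (1 : K) else 0) +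
        t * ∑ E ∈ ℬ \\ ℬ, r E * (if Disjoint E C then (1 : K) else 0)) := by
  calc ∑ E ∈ ℬ \\ ℬ, r E * ∑ C ∈ ℬ, c' C * ((if E ⊆ C then (1 : K) else 0) +
          t * (if Disjoint E C then (1 : K) else 0))
      = ∑ E ∈ ℬ \\ ℬ, ∑ C ∈ ℬ, r E * (c' C * ((if E ⊆ C then (1 : K) else 0) +
          t * (if Disjoint E C then (1 : K) else 0))) := by
        refine sum_congr rfl fun E _ => ?_
        rw [mul_sum]
    _ = ∑ C ∈ ℬ, ∑ E ∈ ℬ \\ ℬ, r E * (c' C * ((if E ⊆ C then (1 : K) else 0) +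
          t * (if Disjoint E C then (1 : K) else 0))) := sum_comm
    _ = ∑ C ∈ ℬ, c' C * (∑ E ∈ ℬ \\ ℬ, r E * (if E ⊆ C then (1 : K) else 0) +
          t * ∑ E ∈ ℬ \\ ℬ, r E * (if Disjoint E C then (1 : K) else 0)) := by
        refine sum_congr rfl fun C _ => ?_
        rw [mul_add, mul_sum, mul_sum, mul_sum, ← sum_add_distrib]
        exact sum_congr rfl fun E _ => by ring

/-- **Reciprocal certificates for one member of every sub-family give the pencil theorem over any field.**
If every nonempty `ℬ ⊆ 𝒜` has a member `A` and coefficient vectors `p q` on `ℬ \\ ℬ` with `Z p = δ_A = Y q` and `Y p = Z q`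
(as functions of `C ∈ ℬ`), then for every `t` with `t * t ≠ 1` the pencil rows `C ↦ (E ↦ [E ⊆ C] + t [E ∩ C = ∅])` of `𝒜`
over `𝒜 \\ 𝒜` are linearly independent over `K`. -/
theorem linearIndependent_pencil_of_certificates (𝒜 : Finset (Finset α))
    (hcert : ∀ ℬ ⊆ 𝒜, ℬ.Nonempty → ∃ A ∈ ℬ, ∃ p q : Finset α → K,
        (∀ C ∈ ℬ, ∑ E ∈ ℬ \\ ℬ, p E * (if E ⊆ C then (1 : K) else 0) = if C = A then 1 else 0) ∧
        (∀ C ∈ ℬ, ∑ E ∈ ℬ \\ ℬ, q E * (if Disjoint E C then (1 : K) else 0) = if C = A then 1 else 0) ∧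
        (∀ C ∈ ℬ, ∑ E ∈ ℬ \\ ℬ, p E * (if Disjoint E C then (1 : K) else 0) =
          ∑ E ∈ ℬ \\ ℬ, q E * (if E ⊆ C then (1 : K) else 0)))
    {t : K} (ht : t * t ≠ 1) :
    LinearIndependent K (fun A : 𝒜 => fun E : (𝒜 \\ 𝒜 : Finset (Finset α)) =>
      (if (E : Finset α) ⊆ (A : Finset α) then (1 : K) else 0) +
        t * (if Disjoint (E : Finset α) (A : Finset α) then (1 : K) else 0)) := by
  classical
  rw [Fintype.linearIndependent_iff]
  intro c hc A₀
  -- the coefficient vector as a function on `Finset α`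
  let c' : Finset α → K := fun C => if h : C ∈ 𝒜 then c ⟨C, h⟩ else 0
  have hc' : ∀ A : 𝒜, c' A = c A := fun A => by
    simp only [c', dif_pos A.2]
  -- pointwise form of the dependency, as a sum over `𝒜`
  have hdep : ∀ E ∈ 𝒜 \\ 𝒜, ∑ C ∈ 𝒜, c' C * ((if E ⊆ C then (1 : K) else 0) +
      t * (if Disjoint E C then (1 : K) else 0)) = 0 := by
    intro E hE
    have h := congr_fun hc ⟨E, hE⟩
    simp only [Finset.sum_apply, Pi.smul_apply, smul_eq_mul, Pi.zero_apply] at h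
    have h' : ∑ x ∈ 𝒜.attach, c x * ((if E ⊆ (x : Finset α) then (1 : K) else 0) +
        t * (if Disjoint E (x : Finset α) then (1 : K) else 0)) = 0 := by
      rwa [← univ_eq_attach]
    rw [← sum_attach 𝒜]
    exact (sum_congr rfl fun A _ => by rw [hc' A]).trans h'
  by_contra hA₀
  -- the support sub-family, nonempty since it contains `A₀`
  set ℬ : Finset (Finset α) := 𝒜.filter (fun C => c' C ≠ 0) with hℬdef
  have hℬsub : ℬ ⊆ 𝒜 := filter_subset _ _
  have hℬne : ℬ.Nonempty := ⟨A₀, mem_filter.mpr ⟨A₀.2, by rw [hc' A₀]; exact hA₀⟩⟩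
  obtain ⟨A, hA, p, q, hp, hq, hpq⟩ := hcert ℬ hℬsub hℬne
  have hDsub : ℬ \\ ℬ ⊆ 𝒜 \\ 𝒜 := diffs_subset hℬsub hℬsub
  -- restrict the dependency to `ℬ`
  have hdepB : ∀ E ∈ ℬ \\ ℬ, ∑ C ∈ ℬ, c' C * ((if E ⊆ C then (1 : K) else 0) +
      t * (if Disjoint E C then (1 : K) else 0)) = 0 := by
    intro E hE
    rw [hℬdef, sum_filter_of_ne (fun C _ h => by
      intro h0; rw [h0, zero_mul] at h; exact h rfl)]
    exact hdep E (hDsub hE)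
  have hδ : ∑ C ∈ ℬ, c' C * (if C = A then (1 : K) else 0) = c' A := by
    simp_rw [mul_boole]
    rw [sum_ite_eq', if_pos hA]
  -- pair the dependency with `p` and with `q`
  set X : K := ∑ C ∈ ℬ, c' C * ∑ E ∈ ℬ \\ ℬ, q E * (if E ⊆ C then (1 : K) else 0) with hX
  have h1 : c' A + t * X = 0 := by
    have e : ∑ E ∈ ℬ \\ ℬ, p E * ∑ C ∈ ℬ, c' C * ((if E ⊆ C then (1 : K) else 0) +
        t * (if Disjoint E C then (1 : K) else 0)) = 0 :=
      sum_eq_zero fun E hE => by rw [hdepB E hE, mul_zero]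
    rw [pair_dependency_aux] at e
    have e3 : ∑ C ∈ ℬ, c' C * (∑ E ∈ ℬ \\ ℬ, p E * (if E ⊆ C then (1 : K) else 0) +
          t * ∑ E ∈ ℬ \\ ℬ, p E * (if Disjoint E C then (1 : K) else 0)) =
        ∑ C ∈ ℬ, (c' C * (if C = A then (1 : K) else 0) +
          t * (c' C * ∑ E ∈ ℬ \\ ℬ, q E * (if E ⊆ C then (1 : K) else 0))) := by
      refine sum_congr rfl fun C hC => ?_
      rw [hp C hC, hpq C hC]; ring
    rw [e3, sum_add_distrib, ← mul_sum, hδ] at e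
    exact e
  have h2 : X + t * c' A = 0 := by
    have e : ∑ E ∈ ℬ \\ ℬ, q E * ∑ C ∈ ℬ, c' C * ((if E ⊆ C then (1 : K) else 0) +
        t * (if Disjoint E C then (1 : K) else 0)) = 0 :=
      sum_eq_zero fun E hE => by rw [hdepB E hE, mul_zero]
    rw [pair_dependency_aux] at e
    have e3 : ∑ C ∈ ℬ, c' C * (∑ E ∈ ℬ \\ ℬ, q E * (if E ⊆ C then (1 : K) else 0) +
          t * ∑ E ∈ ℬ \\ ℬ, q E * (if Disjoint E C then (1 : K) else 0)) =
        ∑ C ∈ ℬ, (c' C * ∑ E ∈ ℬ \\ ℬ, q E * (if E ⊆ C then (1 : K) else 0) +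
          t * (c' C * (if C = A then (1 : K) else 0))) := by
      refine sum_congr rfl fun C hC => ?_
      rw [hq C hC]; ring
    rw [e3, sum_add_distrib, ← mul_sum, hδ] at e
    exact e
  -- `c_A = t² c_A`, so `c_A = 0`, contradicting `A ∈ ℬ`
  have h3 : (1 - t * t) * c' A = 0 := by linear_combination h1 - t * h2
  have hcA : c' A ≠ 0 := (mem_filter.mp hA).2
  rcases mul_eq_zero.mp h3 with h4 | h4
  · exact ht (by linear_combination -h4)
  · exact hcA h4

/-- **Möbius certificate, unique container.**  If every subset of `E` is a column of `ℬ \\ ℬ` and `A` is the only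
member of `ℬ` containing `E`, then `p = 𝟙_{E}`, `q F = (-1)^{#F} [F ⊆ E]` is a reciprocal certificate for `A`. -/
theorem certificate_of_powerset_subset_of_subset_iff (ℬ : Finset (Finset α)) (A E : Finset α)
    (hE : E.powerset ⊆ ℬ \\ ℬ) (hU : ∀ C ∈ ℬ, E ⊆ C ↔ C = A) :
    ∃ p q : Finset α → K,
      (∀ C ∈ ℬ, ∑ F ∈ ℬ \\ ℬ, p F * (if F ⊆ C then (1 : K) else 0) = if C = A then 1 else 0) ∧
      (∀ C ∈ ℬ, ∑ F ∈ ℬ \\ ℬ, q F * (if Disjoint F C then (1 : K) else 0) = if C = A then 1 else 0) ∧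
      (∀ C ∈ ℬ, ∑ F ∈ ℬ \\ ℬ, p F * (if Disjoint F C then (1 : K) else 0) =
        ∑ F ∈ ℬ \\ ℬ, q F * (if F ⊆ C then (1 : K) else 0)) := by
  classical
  have hEmem : E ∈ ℬ \\ ℬ := hE (mem_powerset.mpr subset_rfl)
  have hq : ∀ g : Finset α → K,
      ∑ F ∈ ℬ \\ ℬ, (if F ⊆ E then (-1 : K) ^ #F else 0) * g F = ∑ F ∈ E.powerset, (-1 : K) ^ #F * g F := by
    intro g
    rw [← sum_subset hE (fun F _ hF => by rw [if_neg (fun h => hF (mem_powerset.mpr h)), zero_mul])]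
    exact sum_congr rfl fun F hF => by rw [if_pos (mem_powerset.mp hF)]
  refine ⟨fun F => if F = E then 1 else 0, fun F => if F ⊆ E then (-1 : K) ^ #F else 0, ?_, ?_, ?_⟩
  · intro C hC
    simp only [ite_mul, one_mul, zero_mul]
    rw [sum_ite_eq', if_pos hEmem]
    by_cases h : E ⊆ C
    · rw [if_pos h, if_pos ((hU C hC).mp h)]
    · rw [if_neg h, if_neg (fun h' => h ((hU C hC).mpr h'))]
  · intro C hC
    rw [hq, sum_powerset_neg_one_pow_mul_disjoint]
    by_cases h : E ⊆ C
    · rw [if_pos h, if_pos ((hU C hC).mp h)]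
    · rw [if_neg h, if_neg (fun h' => h ((hU C hC).mpr h'))]
  · intro C hC
    rw [hq, sum_powerset_neg_one_pow_mul_subset]
    simp only [ite_mul, one_mul, zero_mul]
    rw [sum_ite_eq', if_pos hEmem]

/-- **Möbius certificate, unique avoider.**  If every subset of `E` is a column of `ℬ \\ ℬ` and `A` is the only member of `ℬ`
disjoint from `E`, then `p F = (-1)^{#F} [F ⊆ E]`, `q = 𝟙_{E}` is a reciprocal certificate for `A`. -/
theorem certificate_of_powerset_subset_of_disjoint_iff (ℬ : Finset (Finset α)) (A E : Finset α)
    (hE : E.powerset ⊆ ℬ \\ ℬ) (hV : ∀ C ∈ ℬ, Disjoint E C ↔ C = A) :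
    ∃ p q : Finset α → K,
      (∀ C ∈ ℬ, ∑ F ∈ ℬ \\ ℬ, p F * (if F ⊆ C then (1 : K) else 0) = if C = A then 1 else 0) ∧
      (∀ C ∈ ℬ, ∑ F ∈ ℬ \\ ℬ, q F * (if Disjoint F C then (1 : K) else 0) = if C = A then 1 else 0) ∧
      (∀ C ∈ ℬ, ∑ F ∈ ℬ \\ ℬ, p F * (if Disjoint F C then (1 : K) else 0) =
        ∑ F ∈ ℬ \\ ℬ, q F * (if F ⊆ C then (1 : K) else 0)) := by
  classical
  have hEmem : E ∈ ℬ \\ ℬ := hE (mem_powerset.mpr subset_rfl)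
  have hq : ∀ g : Finset α → K,
      ∑ F ∈ ℬ \\ ℬ, (if F ⊆ E then (-1 : K) ^ #F else 0) * g F = ∑ F ∈ E.powerset, (-1 : K) ^ #F * g F := by
    intro g
    rw [← sum_subset hE (fun F _ hF => by rw [if_neg (fun h => hF (mem_powerset.mpr h)), zero_mul])]
    exact sum_congr rfl fun F hF => by rw [if_pos (mem_powerset.mp hF)]
  refine ⟨fun F => if F ⊆ E then (-1 : K) ^ #F else 0, fun F => if F = E then 1 else 0, ?_, ?_, ?_⟩
  · intro C hC
    rw [hq, sum_powerset_neg_one_pow_mul_subset]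
    by_cases h : Disjoint E C
    · rw [if_pos h, if_pos ((hV C hC).mp h)]
    · rw [if_neg h, if_neg (fun h' => h ((hV C hC).mpr h'))]
  · intro C hC
    simp only [ite_mul, one_mul, zero_mul]
    rw [sum_ite_eq', if_pos hEmem]
    by_cases h : Disjoint E C
    · rw [if_pos h, if_pos ((hV C hC).mp h)]
    · rw [if_neg h, if_neg (fun h' => h ((hV C hC).mpr h'))]
  · intro C hC
    rw [hq, sum_powerset_neg_one_pow_mul_disjoint]
    simp only [ite_mul, one_mul, zero_mul]
    rw [sum_ite_eq', if_pos hEmem]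

/-- **Reciprocal column pair.**  Two columns `E, E'` of `ℬ \\ ℬ` such that `A` is the only member containing `E` and the only
member disjoint from `E'`, while the members disjoint from `E` are exactly the members containing `E'`, give the certificate
`p = 𝟙_{E}`, `q = 𝟙_{E'}` (in general position `E = A \ B`, `E' = B \ A`). -/
theorem certificate_of_reciprocal_columns (ℬ : Finset (Finset α)) (A E E' : Finset α)
    (hE : E ∈ ℬ \\ ℬ) (hE' : E' ∈ ℬ \\ ℬ)
    (hU : ∀ C ∈ ℬ, E ⊆ C ↔ C = A) (hV : ∀ C ∈ ℬ, Disjoint E' C ↔ C = A)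
    (hswap : ∀ C ∈ ℬ, Disjoint E C ↔ E' ⊆ C) :
    ∃ p q : Finset α → K,
      (∀ C ∈ ℬ, ∑ F ∈ ℬ \\ ℬ, p F * (if F ⊆ C then (1 : K) else 0) = if C = A then 1 else 0) ∧
      (∀ C ∈ ℬ, ∑ F ∈ ℬ \\ ℬ, q F * (if Disjoint F C then (1 : K) else 0) = if C = A then 1 else 0) ∧
      (∀ C ∈ ℬ, ∑ F ∈ ℬ \\ ℬ, p F * (if Disjoint F C then (1 : K) else 0) =
        ∑ F ∈ ℬ \\ ℬ, q F * (if F ⊆ C then (1 : K) else 0)) := by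
  classical
  refine ⟨fun F => if F = E then 1 else 0, fun F => if F = E' then 1 else 0, ?_, ?_, ?_⟩
  · intro C hC
    simp only [ite_mul, one_mul, zero_mul]
    rw [sum_ite_eq', if_pos hE]
    by_cases h : E ⊆ C
    · rw [if_pos h, if_pos ((hU C hC).mp h)]
    · rw [if_neg h, if_neg (fun h' => h ((hU C hC).mpr h'))]
  · intro C hC
    simp only [ite_mul, one_mul, zero_mul]
    rw [sum_ite_eq', if_pos hE']
    by_cases h : Disjoint E' C
    · rw [if_pos h, if_pos ((hV C hC).mp h)]
    · rw [if_neg h, if_neg (fun h' => h ((hV C hC).mpr h'))]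
  · intro C hC
    simp only [ite_mul, one_mul, zero_mul]
    rw [sum_ite_eq', if_pos hE, sum_ite_eq', if_pos hE']
    by_cases h : Disjoint E C
    · rw [if_pos h, if_pos ((hswap C hC).mp h)]
    · rw [if_neg h, if_neg (fun h' => h ((hswap C hC).mpr h'))]

end OrderedDifferences

end Summit.CriticalPhenomena.PercolationContinuityZ3.Theorems
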